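import Literature.NumberTheory.EllipticCurves.Kato2004.IwasawaTwistTateLimitClassProofs
import Literature.NumberTheory.EllipticCurves.Kato2004.IwasawaH2DataOfInjectivityProofs
import Literature.NumberTheory.EllipticCurves.Kato2004.IwasawaH1FiniteOfInjectivityProofs
import Literature.NumberTheory.EllipticCurves.SelmerInftyTorsionFiniteProofs
import Literature.NumberTheory.EllipticCurves.IsogenyFrobeniusTraceProofs
import HarnessLib

/-!
# Kato (2004), (14.14.1) — left exactness on the pinned Iwasawa cohomology:
  `ker(proj₀ : 𝐇¹_Γ(T_pW) → H¹(ℚ, T_pW)) ⊆ X · 𝐇¹_Γ(T_pW)`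

Literature layer — PROOFS ONLY, no new definitions, no axioms.  Cell `bsd-potss`, seat `bsd-potss-rkm`
(g8); this is the `ι_injective` clause of the member-hull fact `Kato2004.exists_memberHullInputs`
(trust base of item stmt-BirchSwinnertonDyer-19196) made a THEOREM, and with it the named fact
`Kato2004.nonempty_iwasawaH2Data` (through the door `nonempty_iwasawaH2Data_of_forall_isTopGenerator` of
`IwasawaH2DataOfInjectivityProofs`) and the finite generation of `𝐇¹_Γ(T_pW)` over `Λ` (through
`IwasawaH1Data.module_finite_of_proj_zero_injective` of `IwasawaH1FiniteOfInjectivityProofs`).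

THE ARGUMENT (Kato §13.8 "`𝐇¹(T) = lim_n H¹(ℤ[ζ_{p^n}, 1/p], T) = H¹(ℤ[1/p], T ⊗ Λ)` by Shapiro's lemma"
and §14.14 "the exact sequence `0 → T ⊗ Λ →(γ−1) T ⊗ Λ → T → 0`", made explicit in the finite-coefficient
model `𝕋 = lim_{(n,k)} W[p^k] ⊗ ℤ[Gal(ℚ_n/ℚ)]` of `IwasawaTwistTateSystem`).  Let `x ∈ 𝐇¹` with
`proj 0 x = 0` and `x_n = proj n x`.  Files I–III of the chain give `Ξ ∈ H¹(Γ_0, 𝕋)` with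
`H¹(toTate n)(res Ξ) = x_n`, `H¹(toTate 0) Ξ = 0`, and `Θ` with `H¹(shift − 1) Θ = Ξ`.  Here:

* §11 the classes `y_n = H¹(toTate n) (res_{Γ_0→Γ_n} Θ) ∈ H¹(ℚ_n, T)` satisfy
  `conj_γ y_n − y_n = x_n` (`conjMap_sub_layer_class`, from `toTate n (γ⁻¹ν) = γ⁻¹ toTate n (shift ν)`),
  are norm compatible (`layerCores_layer_class`: Shapiro bijectivity level by level and the naturality
  of `cor ∘ H¹(δ_0)`), and integral (`layer_class_mem_integralH1`: for `𝔓 ∤ p`, `I_𝔓 ≤ Γ_∞` as `κ` is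
  cyclotomic, `res_{Γ_n ⊓ I_𝔓} Ξ = 0` by NSW 2.7.5-injectivity for the finite `P_a`, and `H¹(shift − 1)`
  is injective on `H¹(Γ_n ⊓ I_𝔓, 𝕋)` because `Γ_n ⊓ I_𝔓`-invariants of `T` lift along the unit section);
* §12 hence `(y_n)_n = (proj n y)_n` for some `y ∈ 𝐇¹` (`proj_surjective`), `X • y = x`
  (`proj_T_smul`, `ext_of_proj`): **`mem_TSubmodule_of_proj_zero_eq_zero`**; corollaries
  `forall_mem_TSubmodule_of_proj_zero_eq_zero` (the door's hypothesis verbatim),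
  **`nonempty_iwasawaH2Data_holds : nonempty_iwasawaH2Data`**, `IwasawaH1Data.module_finite_of_isCyclotomic`.

References: K. Kato, *p-adic Hodge theory and values of zeta functions of modular forms*, Astérisque 295
(2004), §8.2, §12.2, §13.8, §14.14 [cite: Kato2004Asterisque]; J. Neukirch, A. Schmidt, K. Wingberg,
*Cohomology of Number Fields* (2008), I §5, II §7 [cite: NeukirchSchmidtWingberg2008]; L. C. Washington,
*Introduction to Cyclotomic Fields* (1997), §13.1 [cite: Washington1997].
-/

noncomputable section

open scoped Topology NumberField
open Field Filter CategoryTheory Finset IsDedekindDomain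
open Literature.NumberTheory.GaloisRepresentations
open Literature.NumberTheory.EllipticCurves
open WeierstrassCurve (geomPoints geomTorsion)

namespace Literature.NumberTheory.EllipticCurves.Kato2004

open Literature.NumberTheory.EllipticCurves.Kato2004.EulerSystemValues
open Literature.NumberTheory.EllipticCurves.IwasawaAlgebra

namespace TwistTate

variable (W : WeierstrassCurve ℚ) [W.IsElliptic] (p : ℕ) [Fact p.Prime]
  [ContinuousSMul ℤ_[p] (W.tateModule p)] (κ : ZpExtension ℚ p)

/-! ## §11 The lifted layer classes `y_n = H¹(toTate n) (res_{Γ_0→Γ_n} Θ)` -/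

variable {W p κ} in
/-- **`X` acts as it should: `conj_γ y_n − y_n = proj n x`** for
`y_n = H¹(toTate n) (res_{Γ_0→Γ_n} Θ)` — from `conj_γ ∘ H¹(toTate n) ∘ res = H¹(toTate n) ∘ res ∘ H¹(shift)`
(`conjMap_mapH1AddHom_toTate`), `H¹(shift − 1) Θ = Ξ` and `H¹(toTate n) (res Ξ) = proj n x`.
[cite: Kato2004Asterisque, §13.8 (p. 228) and §14.14 (p. 243)] -/
theorem conjMap_sub_layer_class {γ : absoluteGaloisGroup ℚ} (hγ : κ.IsTopGenerator γ)
    (I : IwasawaH1Data W p κ γ) (x : I.H)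
    [hF : ∀ m m' : ℕ, Fintype (κ.layerSubgroup m ⧸ (κ.layerSubgroup m').subgroupOf (κ.layerSubgroup m))]
    (hcp : ∀ a : ℕ × ℕ, Continuous ((system W p κ).projAddHom a))
    (hcs : ∀ a : ℕ × ℕ,
      Continuous (AddMonoidHom.single (fun _ : ZMod (p ^ a.1) => geomTorsion W ((p : ℤ) ^ a.2)) 0))
    (hct : ∀ n, Continuous (toTate W p κ n)) (hcsf : Continuous (shift W p κ))
    (hcsh : Continuous ⇑(shift W p κ - AddMonoidHom.id (system W p κ).limit))
    (Ξ Θ : continuousCohomology 1 (subgroupRep (system W p κ).limitRep.toTopRep (κ.layerSubgroup 0)))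
    (hΞ : ∀ a : ℕ × ℕ,
        mapH1AddHom (subgroupRep (system W p κ).limitRep.toTopRep (κ.layerSubgroup 0))
          (subgroupRep ((system W p κ).ρ a).toTopRep (κ.layerSubgroup 0)) ((system W p κ).projAddHom a)
          (hcp a) (projAddHom_subgroupRep W p κ a (κ.layerSubgroup 0)) Ξ =
        coresLe ((system W p κ).ρ a).toTopRep (κ.layerSubgroup_antitone (Nat.zero_le a.1))
          (κ.isOpen_layerSubgroup a.1)
          (mapH1AddHom (subgroupRep (W.torsionGaloisModule ((p : ℤ) ^ a.2)).toTopRep (κ.layerSubgroup a.1))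
            (subgroupRep ((system W p κ).ρ a).toTopRep (κ.layerSubgroup a.1))
            (AddMonoidHom.single (fun _ : ZMod (p ^ a.1) => geomTorsion W ((p : ℤ) ^ a.2)) 0) (hcs a)
            (single_subgroupRep W p κ a le_rfl 0) (reduceH1Pk W p a.2 (κ.layerSubgroup a.1) (I.proj a.1 x))))
    (hΘ : mapH1AddHom (subgroupRep (system W p κ).limitRep.toTopRep (κ.layerSubgroup 0))
        (subgroupRep (system W p κ).limitRep.toTopRep (κ.layerSubgroup 0)) (shift W p κ - AddMonoidHom.id (system W p κ).limit)
        hcsh (shift_sub_id_subgroupRep W p κ (κ.layerSubgroup 0)) Θ = Ξ)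
    (n : ℕ) :
    conjMap (tateRep W p).toTopRep (κ.layerSubgroup n) γ 1
        (mapH1AddHom (subgroupRep (system W p κ).limitRep.toTopRep (κ.layerSubgroup n))
          (subgroupRep (tateRep W p).toTopRep (κ.layerSubgroup n)) (toTate W p κ n) (hct n)
          (toTate_subgroupRep W p κ n le_rfl)
          (resLe (system W p κ).limitRep.toTopRep (κ.layerSubgroup_antitone (Nat.zero_le n)) 1 Θ)) -
      mapH1AddHom (subgroupRep (system W p κ).limitRep.toTopRep (κ.layerSubgroup n))
          (subgroupRep (tateRep W p).toTopRep (κ.layerSubgroup n)) (toTate W p κ n) (hct n)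
          (toTate_subgroupRep W p κ n le_rfl)
          (resLe (system W p κ).limitRep.toTopRep (κ.layerSubgroup_antitone (Nat.zero_le n)) 1 Θ) =
      I.proj n x := by
  rw [conjMap_mapH1AddHom_toTate W p κ hγ n (hct n) hcsf Θ, ← map_sub, ← map_sub]
  have hsub : mapH1AddHom (subgroupRep (system W p κ).limitRep.toTopRep (κ.layerSubgroup 0))
      (subgroupRep (system W p κ).limitRep.toTopRep (κ.layerSubgroup 0)) (shift W p κ) hcsf
      (shift_subgroupRep W p κ (κ.layerSubgroup 0)) Θ - Θ = Ξ := by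
    rw [← hΘ, mapH1AddHom_sub_map (X := subgroupRep (system W p κ).limitRep.toTopRep (κ.layerSubgroup 0))
      (Y := subgroupRep (system W p κ).limitRep.toTopRep (κ.layerSubgroup 0)) (shift W p κ)
      (AddMonoidHom.id (system W p κ).limit) hcsf (shift_subgroupRep W p κ (κ.layerSubgroup 0))
      continuous_id (fun _ _ => rfl) hcsh,
      mapH1AddHom_id_map (X := subgroupRep (system W p κ).limitRep.toTopRep (κ.layerSubgroup 0))]
  rw [hsub]
  exact mapH1AddHom_toTate_resLe_limit_class I x hcp hcs hct Ξ hΞ n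

/-- `tateRep` acts by the Galois action on `T_pW`. [cite: Kato2004Asterisque, §13.8 (p. 228)] -/
private theorem tateRep_toTopRep_ρ_apply (g : absoluteGaloisGroup ℚ) (a : W.tateModule p) :
    (tateRep W p).toTopRep.ρ g a = g • a := rfl

variable {W p κ} in
/-- **Norm compatibility of the lifted classes: `Cor_{ℚ_{n+1}→ℚ_n} y_{n+1} = y_n`** for
`y_m = H¹(toTate m) (res_{Γ_0→Γ_m} Θ)`.  Mod `p^k` (which suffices, `eq_of_forall_reduceH1Pk_eq`):
`red_{p^k} y_m = H¹(ev_0) (res (H¹(pr_{(m,k)}) Θ)) =: ȳ_{(m,k)}`, the Shapiro identity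
`H¹(pr_a) Θ = cor (H¹(δ_0) ȳ_a)` (`coresLe_single_mapH1AddHom_eval_resLe`), the compatibility
`H¹(red) H¹(pr_b) Θ = H¹(pr_a) Θ`, the naturality of `cor ∘ H¹(δ_0)` (§6) and the injectivity of
`cor ∘ H¹(δ_0)` give `ȳ_{(n,k)} = cor ȳ_{(n+1,k)}`. [cite: Kato2004Asterisque, §12.2 (p. 220) and §13.8 (p. 228)] -/
theorem layerCores_layer_class {γ : absoluteGaloisGroup ℚ} (I : IwasawaH1Data W p κ γ)
    [hF : ∀ m m' : ℕ, Fintype (κ.layerSubgroup m ⧸ (κ.layerSubgroup m').subgroupOf (κ.layerSubgroup m))]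
    (hcp : ∀ a : ℕ × ℕ, Continuous ((system W p κ).projAddHom a))
    (hcs : ∀ a : ℕ × ℕ,
      Continuous (AddMonoidHom.single (fun _ : ZMod (p ^ a.1) => geomTorsion W ((p : ℤ) ^ a.2)) 0))
    (hct : ∀ n, Continuous (toTate W p κ n))
    (Θ : continuousCohomology 1 (subgroupRep (system W p κ).limitRep.toTopRep (κ.layerSubgroup 0)))
    (n : ℕ) :
    layerCores (tateRep W p) κ n
        (mapH1AddHom (subgroupRep (system W p κ).limitRep.toTopRep (κ.layerSubgroup (n + 1)))
          (subgroupRep (tateRep W p).toTopRep (κ.layerSubgroup (n + 1))) (toTate W p κ (n + 1)) (hct (n + 1))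
          (toTate_subgroupRep W p κ (n + 1) le_rfl)
          (resLe (system W p κ).limitRep.toTopRep (κ.layerSubgroup_antitone (Nat.zero_le (n + 1))) 1 Θ)) =
      (mapH1AddHom (subgroupRep (system W p κ).limitRep.toTopRep (κ.layerSubgroup n))
          (subgroupRep (tateRep W p).toTopRep (κ.layerSubgroup n)) (toTate W p κ n) (hct n)
          (toTate_subgroupRep W p κ n le_rfl)
          (resLe (system W p κ).limitRep.toTopRep (κ.layerSubgroup_antitone (Nat.zero_le n)) 1 Θ)) := by
  have _ := I
  have hce : ∀ a : ℕ × ℕ,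
      Continuous (Pi.evalAddMonoidHom (fun _ : ZMod (p ^ a.1) => geomTorsion W ((p : ℤ) ^ a.2)) 0) :=
    fun _ => continuous_of_discreteTopology
  have hcr : ∀ {a b : ℕ × ℕ} (h : a ≤ b), Continuous (red W p h) := fun _ => continuous_of_discreteTopology
  have hctp : ∀ {k k' : ℕ} (h : k ≤ k'), Continuous (torsionPowReduce W p h) :=
    fun _ => continuous_of_discreteTopology
  refine eq_of_forall_reduceH1Pk_eq W p (κ.layerSubgroup n) fun k => ?_
  have hab : ((n, k) : ℕ × ℕ) ≤ (n + 1, k) := ⟨Nat.le_succ n, le_rfl⟩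
  rw [reduceH1Pk_layerCores, layerCores_eq_coresLe p κ (W.torsionGaloisModule ((p : ℤ) ^ k)) n,
    reduceH1Pk_mapH1AddHom_toTate_resLe W p κ (n + 1) k (hct (n + 1)) (hcp (n + 1, k)) (hce (n + 1, k)) Θ,
    reduceH1Pk_mapH1AddHom_toTate_resLe W p κ n k (hct n) (hcp (n, k)) (hce (n, k)) Θ]
  -- the Shapiro identities `H¹(pr_a) Θ = cor (H¹(δ_0) ȳ_a)` at `a = (n,k)` and `b = (n+1,k)`
  have hSa := coresLe_single_mapH1AddHom_eval_resLe (n, k) (hce (n, k)) (hcs (n, k))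
    (mapH1AddHom (subgroupRep (system W p κ).limitRep.toTopRep (κ.layerSubgroup 0))
          (subgroupRep ((system W p κ).ρ (n, k)).toTopRep (κ.layerSubgroup 0)) ((system W p κ).projAddHom (n, k))
          (hcp (n, k)) (projAddHom_subgroupRep W p κ (n, k) (κ.layerSubgroup 0)) Θ)
  have hSb := coresLe_single_mapH1AddHom_eval_resLe (n + 1, k) (hce (n + 1, k)) (hcs (n + 1, k))
    (mapH1AddHom (subgroupRep (system W p κ).limitRep.toTopRep (κ.layerSubgroup 0))
          (subgroupRep ((system W p κ).ρ (n + 1, k)).toTopRep (κ.layerSubgroup 0)) ((system W p κ).projAddHom (n + 1, k))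
          (hcp (n + 1, k)) (projAddHom_subgroupRep W p κ (n + 1, k) (κ.layerSubgroup 0)) Θ)
  -- `H¹(red) H¹(pr_b) Θ = H¹(pr_a) Θ`, rewritten through the two Shapiro identities and §6
  have hred := mapH1AddHom_red_projAddHom W p κ (κ.layerSubgroup 0) hab (hcr hab) (hcp (n, k))
    (hcp (n + 1, k)) Θ
  rw [← hSb, mapH1AddHom_red_coresLe_single W p κ hab (hcr hab) (hctp hab.2) (hcs (n, k)) (hcs (n + 1, k)),
    ← hSa] at hred
  -- injectivity of `cor ∘ H¹(δ_0)` (left inverse `H¹(ev_0) ∘ res`)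
  have hinj := congrArg (fun z => mapH1AddHom (subgroupRep ((system W p κ).ρ (n, k)).toTopRep (κ.layerSubgroup n))
    (subgroupRep (W.torsionGaloisModule ((p : ℤ) ^ k)).toTopRep (κ.layerSubgroup n))
    (Pi.evalAddMonoidHom (fun _ : ZMod (p ^ n) => geomTorsion W ((p : ℤ) ^ k)) 0) (hce (n, k))
    (eval_subgroupRep W p κ (n, k) le_rfl)
    (resLe ((system W p κ).ρ (n, k)).toTopRep (κ.layerSubgroup_antitone (Nat.zero_le n)) 1 z)) hred
  simp only at hinj
  rw [mapH1AddHom_eval_resLe_coresLe_single (n, k) (hce (n, k)) (hcs (n, k)),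
    mapH1AddHom_eval_resLe_coresLe_single (n, k) (hce (n, k)) (hcs (n, k))] at hinj
  rw [← hinj]
  refine ((mapH1AddHom_congr
    (X := subgroupRep (W.torsionGaloisModule ((p : ℤ) ^ k)).toTopRep (κ.layerSubgroup n))
    (Y := subgroupRep (W.torsionGaloisModule ((p : ℤ) ^ k)).toTopRep (κ.layerSubgroup n))
    (f := torsionPowReduce W p hab.2) (f' := AddMonoidHom.id _)
    (AddMonoidHom.ext fun P => torsionPowReduce_refl W p k P) (hctp hab.2)
    (torsionPowReduce_subgroupRep W p hab.2 (κ.layerSubgroup n)) continuous_id (fun _ _ => rfl) _).trans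
    (mapH1AddHom_id_map
      (X := subgroupRep (W.torsionGaloisModule ((p : ℤ) ^ k)).toTopRep (κ.layerSubgroup n)) _ _ _)).symm

variable {W p κ} in
/-- **Integrality of the lifted classes: `y_n ∈ H¹(ℤ_n[1/p], T)`**.  For `𝔓 ∣ v ≠ p` the inertia
group `I_𝔓` lies in `Γ_∞ = ker κ` (cyclotomic `κ`), so `J = Γ_n ⊓ I_𝔓 ≤ Γ_m ⊓ I_𝔓` for every `m`;
`res_J ξ_a = 0` for all `a` (§7), hence `res_J Ξ = 0` (injectivity of `H¹(J, 𝕋) → lim_a H¹(J, P_a)`,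
NSW 2.7.5 for the finite `P_a`), hence `res_J Θ = 0` (injectivity of `H¹(shift − 1)` on `H¹(J, 𝕋)`:
every `J`-invariant of `T` lifts to a `J`-invariant of `𝕋` by the unit section, `J ≤ ker κ`), hence
`res_J y_n = H¹(toTate n) (res_J Θ) = 0`. [cite: Kato2004Asterisque, §8.2, Lemma 8.5 (pp. 180–184) and §13.8 (p. 228)]
[cite: Washington1997, §13.1] -/
theorem layer_class_mem_integralH1 (hκ : κ.IsCyclotomic) {γ : absoluteGaloisGroup ℚ}
    (I : IwasawaH1Data W p κ γ) (x : I.H)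
    [hF : ∀ m m' : ℕ, Fintype (κ.layerSubgroup m ⧸ (κ.layerSubgroup m').subgroupOf (κ.layerSubgroup m))]
    (hcp : ∀ a : ℕ × ℕ, Continuous ((system W p κ).projAddHom a))
    (hcs : ∀ a : ℕ × ℕ,
      Continuous (AddMonoidHom.single (fun _ : ZMod (p ^ a.1) => geomTorsion W ((p : ℤ) ^ a.2)) 0))
    (hct : ∀ n, Continuous (toTate W p κ n))
    (hcsh : Continuous ⇑(shift W p κ - AddMonoidHom.id (system W p κ).limit))
    (Ξ Θ : continuousCohomology 1 (subgroupRep (system W p κ).limitRep.toTopRep (κ.layerSubgroup 0)))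
    (hΞ : ∀ a : ℕ × ℕ,
        mapH1AddHom (subgroupRep (system W p κ).limitRep.toTopRep (κ.layerSubgroup 0))
          (subgroupRep ((system W p κ).ρ a).toTopRep (κ.layerSubgroup 0)) ((system W p κ).projAddHom a)
          (hcp a) (projAddHom_subgroupRep W p κ a (κ.layerSubgroup 0)) Ξ =
        coresLe ((system W p κ).ρ a).toTopRep (κ.layerSubgroup_antitone (Nat.zero_le a.1))
          (κ.isOpen_layerSubgroup a.1)
          (mapH1AddHom (subgroupRep (W.torsionGaloisModule ((p : ℤ) ^ a.2)).toTopRep (κ.layerSubgroup a.1))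
            (subgroupRep ((system W p κ).ρ a).toTopRep (κ.layerSubgroup a.1))
            (AddMonoidHom.single (fun _ : ZMod (p ^ a.1) => geomTorsion W ((p : ℤ) ^ a.2)) 0) (hcs a)
            (single_subgroupRep W p κ a le_rfl 0) (reduceH1Pk W p a.2 (κ.layerSubgroup a.1) (I.proj a.1 x))))
    (hΘ : mapH1AddHom (subgroupRep (system W p κ).limitRep.toTopRep (κ.layerSubgroup 0))
        (subgroupRep (system W p κ).limitRep.toTopRep (κ.layerSubgroup 0))
        (shift W p κ - AddMonoidHom.id (system W p κ).limit)
        hcsh (shift_sub_id_subgroupRep W p κ (κ.layerSubgroup 0)) Θ = Ξ)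
    (n : ℕ) :
    (mapH1AddHom (subgroupRep (system W p κ).limitRep.toTopRep (κ.layerSubgroup n))
          (subgroupRep (tateRep W p).toTopRep (κ.layerSubgroup n)) (toTate W p κ n) (hct n)
          (toTate_subgroupRep W p κ n le_rfl)
          (resLe (system W p κ).limitRep.toTopRep (κ.layerSubgroup_antitone (Nat.zero_le n)) 1 Θ)) ∈
      integralH1 (tateRep W p) p (κ.layerSubgroup n) := by
  rw [mem_integralH1_iff]
  intro v hv 𝔓 h𝔓
  have hp : p.Prime := Fact.out
  have hI : 𝔓.inertia (absoluteGaloisGroup ℚ) ≤ κ.kerSubgroup :=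
    hκ.inertia_le_kerSubgroup (WeierstrassCurve.natCast_not_mem_asIdeal_of_primesEquiv_ne hp hv) h𝔓
  have hJn : κ.layerSubgroup n ⊓ 𝔓.inertia (absoluteGaloisGroup ℚ) ≤ κ.layerSubgroup n := inf_le_left
  have hJ0 : κ.layerSubgroup n ⊓ 𝔓.inertia (absoluteGaloisGroup ℚ) ≤ κ.layerSubgroup 0 :=
    hJn.trans (κ.layerSubgroup_antitone (Nat.zero_le n))
  have hJker : κ.layerSubgroup n ⊓ 𝔓.inertia (absoluteGaloisGroup ℚ) ≤ κ.kerSubgroup :=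
    inf_le_right.trans hI
  rw [← mapH1AddHom_resLe (X := (system W p κ).limitRep.toTopRep) (Y := (tateRep W p).toTopRep)
      (toTate W p κ n) (hct n) hJn (toTate_subgroupRep W p κ n hJn) (toTate_subgroupRep W p κ n le_rfl),
    resLe_resLe_apply]
  suffices hΘJ : resLe (system W p κ).limitRep.toTopRep hJ0 1 Θ = 0 by
    rw [hΘJ, map_zero]
  -- (ii) `res_J Ξ = 0`: all its projections `res_J ξ_a` vanish (§7, `J ≤ Γ_{a₁} ⊓ I_𝔓`)
  have hcomp : ∀ a : ℕ × ℕ,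
      cohomologyMap ((systemOn W p κ (κ.layerSubgroup n ⊓ 𝔓.inertia (absoluteGaloisGroup ℚ))).projHom a) 1
        (resLe (system W p κ).limitRep.toTopRep hJ0 1 Ξ) = 0 := fun a => by
    have hJa : κ.layerSubgroup n ⊓ 𝔓.inertia (absoluteGaloisGroup ℚ) ≤
        κ.layerSubgroup a.1 ⊓ 𝔓.inertia (absoluteGaloisGroup ℚ) :=
      le_inf (inf_le_right.trans (hI.trans (κ.kerSubgroup_le_layerSubgroup a.1))) inf_le_right
    have ha1 : κ.layerSubgroup a.1 ⊓ 𝔓.inertia (absoluteGaloisGroup ℚ) ≤ κ.layerSubgroup a.1 := inf_le_left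
    rw [cohomologyMap_systemOn_projHom W p κ _ a (hcp a),
      mapH1AddHom_resLe (X := (system W p κ).limitRep.toTopRep) (Y := ((system W p κ).ρ a).toTopRep)
        ((system W p κ).projAddHom a) (hcp a) hJ0 (projAddHom_subgroupRep W p κ a _)
        (projAddHom_subgroupRep W p κ a (κ.layerSubgroup 0)), hΞ a,
      ← resLe_resLe_apply ((system W p κ).ρ a).toTopRep (hJa.trans ha1)
        (κ.layerSubgroup_antitone (Nat.zero_le a.1)),
      ← resLe_resLe_apply ((system W p κ).ρ a).toTopRep hJa ha1,
      resLe_coresLe_single_eq_zero_of_mem_integralH1 W p κ a (hcs a) hv h𝔓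
        (reduceH1Pk_mem_integralH1 W p a.2 _ (I.proj_mem a.1 x)), map_zero]
    rfl
  have hzero : (systemOn W p κ (κ.layerSubgroup n ⊓ 𝔓.inertia (absoluteGaloisGroup ℚ))).toCohomologyLimit₁
      (resLe (system W p κ).limitRep.toTopRep hJ0 1 Ξ) = 0 := by
    refine Subtype.ext (funext fun a => ?_)
    rw [DiscreteInvSystem.coe_toCohomologyLimit₁_apply, hcomp a]
    rfl
  have hΞJ : resLe (system W p κ).limitRep.toTopRep hJ0 1 Ξ = 0 :=
    (systemOn W p κ (κ.layerSubgroup n ⊓ 𝔓.inertia (absoluteGaloisGroup ℚ))).toCohomologyLimit₁_injective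
      (diagonalChainOn W p κ _) (finite_coeff W p) (hzero.trans (map_zero _).symm)
  -- (iii) injectivity of `H¹(shift − 1)` on `H¹(J, 𝕋)`
  have hinj := mapH1AddHom_injective_of_forall_exists_invariant
    (X₁ := subgroupRep (system W p κ).limitRep.toTopRep (κ.layerSubgroup n ⊓ 𝔓.inertia (absoluteGaloisGroup ℚ)))
    (X₂ := subgroupRep (system W p κ).limitRep.toTopRep (κ.layerSubgroup n ⊓ 𝔓.inertia (absoluteGaloisGroup ℚ)))
    (X₃ := subgroupRep (tateRep W p).toTopRep (κ.layerSubgroup n ⊓ 𝔓.inertia (absoluteGaloisGroup ℚ)))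
    (shift W p κ - AddMonoidHom.id (system W p κ).limit) hcsh
    (shift_sub_id_subgroupRep W p κ (κ.layerSubgroup n ⊓ 𝔓.inertia (absoluteGaloisGroup ℚ)))
    (toTate W p κ 0) (injective_shift_sub W p κ) (toTate_subgroupRep W p κ 0 hJ0)
    (toTate_zero_shift_sub_id W p κ)
    (fun μ hμ => by
      obtain ⟨ν, hν⟩ := exists_shift_sub_eq_of_toTate_zero_eq_zero W p κ μ hμ
      exact ⟨ν, hν⟩)
    (fun v hv => by
      obtain ⟨μ, hμ, hμv⟩ := exists_invariant_lift W p κ hJker v fun g hg => by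
        have := hv ⟨g, hg⟩
        rw [subgroupRep_ρ_apply] at this
        rw [tateRep_toTopRep_ρ_apply W p] at this
        exact this
      exact ⟨μ, fun σ => hμ σ σ.2, hμv⟩)
  refine hinj ?_
  rw [map_zero, mapH1AddHom_resLe (X := (system W p κ).limitRep.toTopRep)
      (Y := (system W p κ).limitRep.toTopRep) (shift W p κ - AddMonoidHom.id (system W p κ).limit) hcsh hJ0 _
      (shift_sub_id_subgroupRep W p κ (κ.layerSubgroup 0)), hΘ, hΞJ]

/-! ## §12 Kato (14.14.1), left exactness on the pin: `ker(proj 0) ⊆ X · 𝐇¹` -/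

/-- **Kato (14.14.1), injectivity half, on the pinned Iwasawa cohomology `𝐇¹_Γ(T_pW)`** — the
`ι_injective` clause of `Kato2004.exists_memberHullInputs`: for the cyclotomic `ℤ_p`-extension, a
topological generator `γ` and a pin `I : IwasawaH1Data W p κ γ`, every `x ∈ 𝐇¹` with `proj 0 x = 0` lies
in `X · 𝐇¹`.  PROOF (Kato §13.8 / §14.14 made explicit in the finite-coefficient Shapiro model
`𝕋 = lim_{(n,k)} W[p^k] ⊗ ℤ[Gal(ℚ_n/ℚ)]`, `0 → 𝕋 →(γ−1) 𝕋 → T → 0`): the layer classes `x_n = proj n x`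
give a compatible family `ξ_a = cor (H¹(δ_0) (x_{a₁} mod p^{a₂})) ∈ lim_a H¹(Γ_0, P_a) = H¹(Γ_0, 𝕋)`
(NSW 2.7.5), i.e. a class `Ξ` with `H¹(toTate 0) Ξ = x_0 = 0`; exactness of
`H¹(Γ_0, 𝕋) →(γ−1) H¹(Γ_0, 𝕋) → H¹(Γ_0, T)` (the kernel `𝕋 →(γ−1) 𝕋` is a closed embedding of compact
groups) gives `Θ` with `(γ − 1) Θ = Ξ`; the classes `y_n = H¹(toTate n) (res Θ)` are norm compatible and
integral (`layerCores_layer_class`, `layer_class_mem_integralH1`), so come from some `y ∈ 𝐇¹`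
(`proj_surjective`), and `(conj_γ − 1) y_n = x_n` (`conjMap_sub_layer_class`), i.e. `X • y = x`
(`proj_T_smul`, `ext_of_proj`). [cite: Kato2004Asterisque, §13.8 (p. 228) and §14.14 (14.14.1) (p. 243)]
[cite: NeukirchSchmidtWingberg2008, II §7 Thm 2.7.5] -/
theorem mem_TSubmodule_of_proj_zero_eq_zero (hκ : κ.IsCyclotomic) {γ : absoluteGaloisGroup ℚ}
    (hγ : κ.IsTopGenerator γ) (I : IwasawaH1Data W p κ γ) (x : I.H) (hx : I.proj 0 x = 0) :
    x ∈ TSubmodule p I.H := by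
  classical
  have hp : p.Prime := Fact.out
  haveI hfin : ∀ m : ℕ, (κ.layerSubgroup m).FiniteIndex := fun m =>
    ⟨by rw [κ.index_layerSubgroup m]; exact pow_ne_zero _ hp.ne_zero⟩
  haveI hF : ∀ m m' : ℕ,
      Fintype (κ.layerSubgroup m ⧸ (κ.layerSubgroup m').subgroupOf (κ.layerSubgroup m)) :=
    fun _ _ => Fintype.ofFinite _
  have hcp : ∀ a : ℕ × ℕ, Continuous ((system W p κ).projAddHom a) := (system W p κ).continuous_projAddHom
  have hcs : ∀ a : ℕ × ℕ,
      Continuous (AddMonoidHom.single (fun _ : ZMod (p ^ a.1) => geomTorsion W ((p : ℤ) ^ a.2)) 0) :=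
    fun _ => continuous_of_discreteTopology
  have hct : ∀ n, Continuous (toTate W p κ n) := continuous_toTate W p κ
  have hcsf : Continuous (shift W p κ) := continuous_shift W p κ
  have hcsh : Continuous ⇑(shift W p κ - AddMonoidHom.id (system W p κ).limit) := continuous_shift_sub W p κ
  obtain ⟨Ξ, hΞ⟩ := exists_limit_class I x hcp hcs
  obtain ⟨Θ, hΘ⟩ := exists_shift_sub_class W p κ hcsh (hct 0) Ξ
    (mapH1AddHom_toTate_zero_limit_class I x hcp hcs hct Ξ hΞ hx)
  obtain ⟨y, hy⟩ := I.proj_surjective (fun n => (mapH1AddHom (subgroupRep (system W p κ).limitRep.toTopRep (κ.layerSubgroup n))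
          (subgroupRep (tateRep W p).toTopRep (κ.layerSubgroup n)) (toTate W p κ n) (hct n)
          (toTate_subgroupRep W p κ n le_rfl)
          (resLe (system W p κ).limitRep.toTopRep (κ.layerSubgroup_antitone (Nat.zero_le n)) 1 Θ)))
    ⟨fun n => layer_class_mem_integralH1 hκ I x hcp hcs hct hcsh Ξ Θ hΞ hΘ n,
      fun n => layerCores_layer_class I hcp hcs hct Θ n⟩
  have hXy : (PowerSeries.X : IwasawaAlgebra p) • y = x := I.ext_of_proj fun n => by
    rw [I.proj_T_smul, hy n]
    exact conjMap_sub_layer_class hγ I x hcp hcs hct hcsf hcsh Ξ Θ hΞ hΘ n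
  rw [← hXy]
  exact X_smul_mem_TSubmodule p I.H y

end TwistTate

/-- **Kato (14.14.1), injectivity half — in the universally quantified shape consumed by
`Kato2004.nonempty_iwasawaH2Data_of_forall_isTopGenerator`** (the `ι_injective` clause of
`exists_memberHullInputs`, for every curve, prime, continuity instance, cyclotomic `κ`, generator and
pin). [cite: Kato2004Asterisque, §14.14 (14.14.1) (p. 243)] -/
theorem forall_mem_TSubmodule_of_proj_zero_eq_zero :
    ∀ (W : WeierstrassCurve ℚ) [W.IsElliptic] (p : ℕ) [Fact p.Prime]
      [ContinuousSMul ℤ_[p] (W.tateModule p)] (κ : ZpExtension ℚ p) (γ : absoluteGaloisGroup ℚ),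
      κ.IsCyclotomic → κ.IsTopGenerator γ → ∀ (I : IwasawaH1Data W p κ γ) (x : I.H),
        I.proj 0 x = 0 → x ∈ TSubmodule p I.H :=
  fun W _ p _ _ κ _ hκ hγ I x hx => TwistTate.mem_TSubmodule_of_proj_zero_eq_zero W p κ hκ hγ I x hx

/-- **The (14.14.1) package is inhabited for every pin** — the named fact `Kato2004.nonempty_iwasawaH2Data`
DISCHARGED: `IwasawaH2Data W p κ γ I` (the module `𝐇²`, the injection `𝐇¹/T ↪ H¹(ℚ, T)` with image
`proj₀(𝐇¹)`) exists for every cyclotomic `κ`, generator `γ` and pin `I`, by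
`nonempty_iwasawaH2Data_of_forall_isTopGenerator` and the injectivity theorem above.
[cite: Kato2004Asterisque, §14.14 (14.14.1)–(14.14.4) (p. 243)] -/
theorem nonempty_iwasawaH2Data_holds : nonempty_iwasawaH2Data :=
  nonempty_iwasawaH2Data_of_forall_isTopGenerator forall_mem_TSubmodule_of_proj_zero_eq_zero

/-- **`𝐇¹_Γ(T_pW)` is a finitely generated `Λ`-module for every pin** (Kato (12.2.1) / §13.8: `𝐇¹` is
`Λ`-free of rank one, in particular finitely generated) — from the injectivity theorem by the tree's
compact-Nakayama argument `IwasawaH1Data.module_finite_of_proj_zero_injective`.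
[cite: Kato2004Asterisque, §12.2 (12.2.1) (p. 220) and §14.14 (14.14.1) (p. 243)] -/
theorem IwasawaH1Data.module_finite_of_isCyclotomic {W : WeierstrassCurve ℚ} [W.IsElliptic] {p : ℕ}
    [Fact p.Prime] [ContinuousSMul ℤ_[p] (W.tateModule p)] {κ : ZpExtension ℚ p} (hκ : κ.IsCyclotomic)
    {γ : absoluteGaloisGroup ℚ} (hγ : κ.IsTopGenerator γ) (I : IwasawaH1Data W p κ γ) :
    Module.Finite (IwasawaAlgebra p) I.H :=
  I.module_finite_of_proj_zero_injective fun x hx =>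
    TwistTate.mem_TSubmodule_of_proj_zero_eq_zero W p κ hκ hγ I x hx


end Literature.NumberTheory.EllipticCurves.Kato2004

end
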